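import Summits.QuantumFields.YangMills.Theorems.ColdStartUniversalityLatticeLangevinCarreMollifier
import Summits.QuantumFields.YangMills.Theorems.ColdStartUniversalityLatticeLangevinLocalPoincare
import HarnessLib

/-!
# Route `ColdStartUniversality` (fixed-cut-off package, Bakry–Émery side): the DYNAMIC VARIANCE BOUND along every SZZ solution for `C¹`
# (LIPSCHITZ) DATA — the `C⁵` hypothesis of `wilson_solution_variance_le_uniform` removed

Helper file (seat `ym-line-csu-p1`, g29; `--supports stmt-QuantumFields-24809`).  By the C⁵ approximation with carré du champ control
(`exists_contDiff_five_approx_of_carre_le`: `|g − f| ≤ η` on the group, `Γ^A(g) ≤ (σ+η)²`), the elementary inequality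
`Var(X + Y) ≤ (1+λ)Var X + (1+λ⁻¹)Var Y` and two limits `η → 0`, `λ → 0`:
* ★★★ `wilson_solution_variance_le_of_contDiff_one` — at `|β'| < 1/12`, for every `C¹` `f` with `Γ^A(f) ≤ σ²` on the group, every strong SZZ
  solution `U` from a deterministic start and every `t ≥ 0`:  `E[f(coords U_t)²] − (E f(coords U_t))² ≤ σ²/(2(1−12|β'|))`.
THEOREMS ONLY, no definition, no sorry.  [cite: BakryGentilLedoux2014, Thm 4.7.2 (ii)].  HONEST FRAMING: fixed cut-off, FIXED `|β'| < 1/12`, uniform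
in `L`, start and time only; nothing `K`-uniform; `UniformColdStartMixing` (stmt-24809, aside) NOT restated; the Yang–Mills mass gap is NOT proved.
-/

set_option autoImplicit false

noncomputable section

namespace Summit.QuantumFields.YangMills.Theorems.ColdStartUniversality

open MeasureTheory ProbabilityTheory Matrix Complex Finset Filter Set Metric
open scoped ComplexConjugate BigOperators Matrix NNReal ENNReal Topology
open Literature.Probability.Process Literature.MathematicalPhysics.QuantumFieldTheory
open Literature.MathematicalPhysics.QuantumLattice (fundamentalRep fundamentalLatticeRep continuous_fundamentalRep fundamentalRep_apply)

variable {L : ℕ} [NeZero L]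

/-- **Variance bookkeeping** on a probability space: for bounded measurable `a` and `b`,
`∫ a² − (∫ a)² ≤ (1+λ)·(∫ b² − (∫ b)²) + (1+λ⁻¹)·∫ (a − b)²` for every `λ > 0`. [folklore] -/
theorem variance_le_of_young {Ω : Type} [MeasurableSpace Ω] (P : Measure Ω) [IsProbabilityMeasure P] {a b : Ω → ℝ}
    (ha : AEStronglyMeasurable a P) (hb : AEStronglyMeasurable b P) {Ma Mb : ℝ} (hMa : ∀ ω, |a ω| ≤ Ma) (hMb : ∀ ω, |b ω| ≤ Mb)
    {lam : ℝ} (hlam : 0 < lam) :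
    ∫ ω, a ω * a ω ∂P - (∫ ω, a ω ∂P) ^ 2 ≤
      (1 + lam) * (∫ ω, b ω * b ω ∂P - (∫ ω, b ω ∂P) ^ 2) + (1 + lam⁻¹) * ∫ ω, (a ω - b ω) ^ 2 ∂P := by
  -- integrability of everything in sight
  have bnd : ∀ {u : Ω → ℝ} {M : ℝ}, AEStronglyMeasurable u P → (∀ ω, |u ω| ≤ M) → Integrable u P := @fun u M hu hM =>
    Integrable.of_bound hu M (ae_of_all _ fun ω => by rw [Real.norm_eq_abs]; exact hM ω)
  have ia : Integrable a P := bnd ha hMa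
  have ib : Integrable b P := bnd hb hMb
  have hprod : ∀ {u v : Ω → ℝ} {M N : ℝ}, AEStronglyMeasurable u P → AEStronglyMeasurable v P → (∀ ω, |u ω| ≤ M) → (∀ ω, |v ω| ≤ N) →
      Integrable (fun ω => u ω * v ω) P := @fun u v M N hu hv hM hN => by
    refine Integrable.of_bound (hu.mul hv) (M * N) (ae_of_all _ fun ω => ?_)
    rw [Real.norm_eq_abs, abs_mul]
    exact mul_le_mul (hM ω) (hN ω) (abs_nonneg _) ((abs_nonneg _).trans (hM ω))
  have iaa : Integrable (fun ω => a ω * a ω) P := hprod ha ha hMa hMa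
  have ibb : Integrable (fun ω => b ω * b ω) P := hprod hb hb hMb hMb
  have iab : Integrable (fun ω => a ω * b ω) P := hprod ha hb hMa hMb
  set ma : ℝ := ∫ ω, a ω ∂P with hma
  set mb : ℝ := ∫ ω, b ω ∂P with hmb
  -- centred variables `p = b − mb`, `q = (a − b) − (ma − mb)`, `a − ma = p + q`
  -- `∫ (a−ma)² = ∫ a² − ma²`, `∫ p² = ∫ b² − mb²`, `∫ q² ≤ ∫ (a−b)²`
  have e_a : ∫ ω, (a ω - ma) ^ 2 ∂P = ∫ ω, a ω * a ω ∂P - ma ^ 2 := by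
    have e1 : (fun ω => (a ω - ma) ^ 2) = fun ω => a ω * a ω - 2 * ma * a ω + ma ^ 2 := by funext ω; ring
    have i2 : Integrable (fun ω => 2 * ma * a ω) P := ia.const_mul _
    have i12 : Integrable (fun ω => a ω * a ω - 2 * ma * a ω) P := iaa.sub i2
    rw [e1, integral_add i12 (integrable_const _), integral_sub iaa i2, integral_const_mul, integral_const]
    simp only [probReal_univ, smul_eq_mul, one_mul]
    rw [← hma]; ring
  have e_b : ∫ ω, (b ω - mb) ^ 2 ∂P = ∫ ω, b ω * b ω ∂P - mb ^ 2 := by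
    have e1 : (fun ω => (b ω - mb) ^ 2) = fun ω => b ω * b ω - 2 * mb * b ω + mb ^ 2 := by funext ω; ring
    have i2 : Integrable (fun ω => 2 * mb * b ω) P := ib.const_mul _
    have i12 : Integrable (fun ω => b ω * b ω - 2 * mb * b ω) P := ibb.sub i2
    rw [e1, integral_add i12 (integrable_const _), integral_sub ibb i2, integral_const_mul, integral_const]
    simp only [probReal_univ, smul_eq_mul, one_mul]
    rw [← hmb]; ring
  have iw : Integrable (fun ω => a ω - b ω) P := ia.sub ib
  have iww : Integrable (fun ω => (a ω - b ω) ^ 2) P := by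
    have : (fun ω => (a ω - b ω) ^ 2) = fun ω => a ω * a ω - 2 * (a ω * b ω) + b ω * b ω := by funext ω; ring
    rw [this]; exact (iaa.sub (iab.const_mul _)).add ibb
  have e_w : ∫ ω, ((a ω - b ω) - (ma - mb)) ^ 2 ∂P = ∫ ω, (a ω - b ω) ^ 2 ∂P - (ma - mb) ^ 2 := by
    have e1 : (fun ω => ((a ω - b ω) - (ma - mb)) ^ 2) = fun ω => (a ω - b ω) ^ 2 - 2 * (ma - mb) * (a ω - b ω) + (ma - mb) ^ 2 := by
      funext ω; ring
    have i2 : Integrable (fun ω => 2 * (ma - mb) * (a ω - b ω)) P := iw.const_mul _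
    have i12 : Integrable (fun ω => (a ω - b ω) ^ 2 - 2 * (ma - mb) * (a ω - b ω)) P := iww.sub i2
    rw [e1, integral_add i12 (integrable_const _), integral_sub iww i2, integral_const_mul, integral_sub ia ib, integral_const]
    simp only [probReal_univ, smul_eq_mul, one_mul]
    rw [← hma, ← hmb]; ring
  -- Young: `(p+q)² ≤ (1+λ)p² + (1+λ⁻¹)q²`
  have hl0 : lam ≠ 0 := hlam.ne'
  have young : ∀ p q : ℝ, (p + q) ^ 2 ≤ (1 + lam) * p ^ 2 + (1 + lam⁻¹) * q ^ 2 := by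
    intro p q
    have key : 2 * p * q ≤ lam * p ^ 2 + lam⁻¹ * q ^ 2 := by
      rw [← sub_nonneg]
      have e : lam * p ^ 2 + lam⁻¹ * q ^ 2 - 2 * p * q = lam⁻¹ * (lam * p - q) ^ 2 := by
        field_simp
        ring
      rw [e]
      positivity
    linarith [key]
  have ipp : Integrable (fun ω => (b ω - mb) ^ 2) P := by
    have : (fun ω => (b ω - mb) ^ 2) = fun ω => b ω * b ω - 2 * mb * b ω + mb ^ 2 := by funext ω; ring
    rw [this]; exact (ibb.sub (ib.const_mul _)).add (integrable_const _)
  have iqq : Integrable (fun ω => ((a ω - b ω) - (ma - mb)) ^ 2) P := by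
    have : (fun ω => ((a ω - b ω) - (ma - mb)) ^ 2) = fun ω => (a ω - b ω) ^ 2 - 2 * (ma - mb) * (a ω - b ω) + (ma - mb) ^ 2 := by
      funext ω; ring
    rw [this]; exact (iww.sub (iw.const_mul _)).add (integrable_const _)
  have hmain : ∫ ω, (a ω - ma) ^ 2 ∂P ≤ (1 + lam) * ∫ ω, (b ω - mb) ^ 2 ∂P + (1 + lam⁻¹) * ∫ ω, ((a ω - b ω) - (ma - mb)) ^ 2 ∂P := by
    rw [← integral_const_mul, ← integral_const_mul, ← integral_add (ipp.const_mul _) (iqq.const_mul _)]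
    refine integral_mono_of_nonneg (ae_of_all _ fun ω => sq_nonneg _) ((ipp.const_mul _).add (iqq.const_mul _)) (ae_of_all _ fun ω => ?_)
    show (a ω - ma) ^ 2 ≤ (1 + lam) * (b ω - mb) ^ 2 + (1 + lam⁻¹) * ((a ω - b ω) - (ma - mb)) ^ 2
    have e : a ω - ma = (b ω - mb) + ((a ω - b ω) - (ma - mb)) := by ring
    rw [e]
    exact young _ _
  rw [e_a, e_b, e_w] at hmain
  have hl : 0 ≤ 1 + lam⁻¹ := by positivity
  nlinarith [hmain, hl, sq_nonneg (ma - mb), mul_nonneg hl (sq_nonneg (ma - mb))]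

/-- ★★★ **Dynamic variance bound along every SZZ solution for `C¹` data.**  At `|β'| < 1/12`, for every `L`, every `C¹` `f` with `Γ^A(f) ≤ σ²`
on the group, every filtered probability space carrying a flat Brownian driver, every strong solution `U` of the SZZ Langevin SDE from a
deterministic start `U_0 ≡ x₀` and every `t ≥ 0`:  `E[f(coords U_t)²] − (E f(coords U_t))² ≤ σ²/(2(1−12|β'|))`. [cite: BakryGentilLedoux2014, Thm 4.7.2 (ii)] -/
theorem wilson_solution_variance_le_of_contDiff_one (L : ℕ) [NeZero L] (β' : ℝ) (hβ : |β'| < 1 / 12) (t : ℝ≥0) (x₀ : (GaugeConfig 3 L (Matrix.specialUnitaryGroup (Fin 2) ℂ)))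
    {σ : ℝ} (hσ : 0 ≤ σ) {f : (Edge 3 L × Fin 2 × Fin 2 × Bool → ℝ) → ℝ} (hf : ContDiff ℝ 1 f)
    (Ω : Type) [MeasurableSpace Ω] (P : Measure Ω) [IsProbabilityMeasure P]
    (W : ℝ≥0 → Ω → (Edge 3 L × NoiseIdx 2 → ℝ)) (hW : IsFlatBrownian W P)
    (U : ℝ≥0 → Ω → (GaugeConfig 3 L (Matrix.specialUnitaryGroup (Fin 2) ℂ))) (hU0 : ∀ ω, U 0 ω = x₀)
    (hU : (latticeLangevinDynamics (fundamentalLatticeRep 2) β').IsSolution (fundamentalRep (Fin 2)) hW.natFiltration P W U) :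
    let coords : GaugeConfig 3 L (Matrix.specialUnitaryGroup (Fin 2) ℂ) → (Edge 3 L × Fin 2 × Fin 2 × Bool → ℝ) :=
      fun V q => (fun z : ℂ => if q.2.2.2 then z.im else z.re)
        ((fundamentalRep (Fin 2) (V q.1) : Matrix (Fin 2) (Fin 2) ℂ) q.2.1 q.2.2.1)
    let A : GaugeConfig 3 L (Matrix.specialUnitaryGroup (Fin 2) ℂ) → (Edge 3 L × Fin 2 × Fin 2 × Bool) →
        (Edge 3 L × Fin 2 × Fin 2 × Bool) → ℝ := fun V i j =>
      ∑ n : Edge 3 L × NoiseIdx 2,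
        (if n.1 = i.1 then (fun z : ℂ => if i.2.2.2 then z.im else z.re)
          ((latticeLangevinDynamics (fundamentalLatticeRep 2) β').noise
            (matrixConfig (fundamentalRep (Fin 2)) V) i.1 n.2 i.2.1 i.2.2.1) else 0) *
        (if n.1 = j.1 then (fun z : ℂ => if j.2.2.2 then z.im else z.re)
          ((latticeLangevinDynamics (fundamentalLatticeRep 2) β').noise
            (matrixConfig (fundamentalRep (Fin 2)) V) j.1 n.2 j.2.1 j.2.2.1) else 0)
    (∀ y, (∑ i : Edge 3 L × Fin 2 × Fin 2 × Bool, ∑ j : Edge 3 L × Fin 2 × Fin 2 × Bool, fderiv ℝ f (coords y) (Pi.single i 1) * fderiv ℝ f (coords y) (Pi.single j 1) * A y i j) ≤ σ ^ 2) →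
    ∫ ω, f (coords (U t ω)) * f (coords (U t ω)) ∂P - (∫ ω, f (coords (U t ω)) ∂P) ^ 2 ≤ σ ^ 2 / (2 * (1 - 12 * |β'|)) := by
  intro coords A hΓ
  classical
  haveI := secondCountableTopology_su2
  haveI := borelSpace_config L
  have hρ : 0 < (1 - 12 * |β'|) := by linarith
  have hco : Continuous coords := continuous_coords (L := L)
  have hmU : Measurable (U t) := (hU.adapted t).mono (hW.natFiltration.le t) le_rfl
  have cF : Continuous fun y : (GaugeConfig 3 L (Matrix.specialUnitaryGroup (Fin 2) ℂ)) => f (coords y) := hf.continuous.comp hco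
  obtain ⟨Ma, hMa⟩ : ∃ C, ∀ y : (GaugeConfig 3 L (Matrix.specialUnitaryGroup (Fin 2) ℂ)), |f (coords y)| ≤ C := by
    obtain ⟨C, hC⟩ := isCompact_univ.exists_bound_of_continuousOn cF.continuousOn
    exact ⟨C, fun y => by simpa [Real.norm_eq_abs] using hC y (Set.mem_univ y)⟩
  have ha : AEStronglyMeasurable (fun ω => f (coords (U t ω))) P := (cF.measurable.comp hmU).aestronglyMeasurable
  set Va : ℝ := ∫ ω, f (coords (U t ω)) * f (coords (U t ω)) ∂P - (∫ ω, f (coords (U t ω)) ∂P) ^ 2 with hVa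
  -- step 1: for every `λ > 0` and `η > 0`, `Va ≤ (1+λ)(σ+η)²/(2ρ) + (1+λ⁻¹)η²`
  have step : ∀ lam : ℝ, 0 < lam → ∀ η : ℝ, 0 < η → Va ≤ (1 + lam) * ((σ + η) ^ 2 / (2 * (1 - 12 * |β'|))) + (1 + lam⁻¹) * η ^ 2 := by
    intro lam hlam η hη
    obtain ⟨g, hg5, hg0, hgΓ⟩ := exists_contDiff_five_approx_of_carre_le L β' hf hσ hη hΓ
    have hvg : ∫ ω, g (coords (U t ω)) * g (coords (U t ω)) ∂P - (∫ ω, g (coords (U t ω)) ∂P) ^ 2 ≤ (σ + η) ^ 2 / (2 * (1 - 12 * |β'|)) :=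
      wilson_solution_variance_le_uniform L β' hβ hg5 t x₀ Ω P W hW U hU0 hU hgΓ
    have cG : Continuous fun y : (GaugeConfig 3 L (Matrix.specialUnitaryGroup (Fin 2) ℂ)) => g (coords y) := hg5.continuous.comp hco
    obtain ⟨Mb, hMb⟩ : ∃ C, ∀ y : (GaugeConfig 3 L (Matrix.specialUnitaryGroup (Fin 2) ℂ)), |g (coords y)| ≤ C := by
      obtain ⟨C, hC⟩ := isCompact_univ.exists_bound_of_continuousOn cG.continuousOn
      exact ⟨C, fun y => by simpa [Real.norm_eq_abs] using hC y (Set.mem_univ y)⟩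
    have hb : AEStronglyMeasurable (fun ω => g (coords (U t ω))) P := (cG.measurable.comp hmU).aestronglyMeasurable
    have hy := variance_le_of_young P ha hb (fun ω => hMa _) (fun ω => hMb _) hlam
    have hw : ∫ ω, (f (coords (U t ω)) - g (coords (U t ω))) ^ 2 ∂P ≤ η ^ 2 := by
      have hn := norm_integral_le_of_norm_le_const (μ := P) (f := fun ω => (f (coords (U t ω)) - g (coords (U t ω))) ^ 2) (C := η ^ 2)
        (ae_of_all _ fun ω => by
          rw [Real.norm_eq_abs, abs_pow, abs_sub_comm]
          exact pow_le_pow_left₀ (abs_nonneg _) (hg0 _) 2)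
      rw [probReal_univ, mul_one, Real.norm_eq_abs] at hn
      exact (le_abs_self _).trans hn
    have hl : 0 ≤ 1 + lam⁻¹ := by positivity
    calc Va ≤ (1 + lam) * (∫ ω, g (coords (U t ω)) * g (coords (U t ω)) ∂P - (∫ ω, g (coords (U t ω)) ∂P) ^ 2) +
          (1 + lam⁻¹) * ∫ ω, (f (coords (U t ω)) - g (coords (U t ω))) ^ 2 ∂P := hy
      _ ≤ (1 + lam) * ((σ + η) ^ 2 / (2 * (1 - 12 * |β'|))) + (1 + lam⁻¹) * η ^ 2 :=
          add_le_add (mul_le_mul_of_nonneg_left hvg (by positivity)) (mul_le_mul_of_nonneg_left hw hl)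
  -- step 2: let `η → 0⁺`, then `λ → 0⁺`
  have step2 : ∀ lam : ℝ, 0 < lam → Va ≤ (1 + lam) * (σ ^ 2 / (2 * (1 - 12 * |β'|))) := by
    intro lam hlam
    have hcont : Continuous fun η : ℝ => (1 + lam) * ((σ + η) ^ 2 / (2 * (1 - 12 * |β'|))) + (1 + lam⁻¹) * η ^ 2 :=
      (continuous_const.mul (((continuous_const.add continuous_id).pow 2).div_const _)).add (continuous_const.mul (continuous_id.pow 2))
    have htend : Tendsto (fun η : ℝ => (1 + lam) * ((σ + η) ^ 2 / (2 * (1 - 12 * |β'|))) + (1 + lam⁻¹) * η ^ 2) (𝓝[>] 0)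
        (𝓝 ((1 + lam) * ((σ + 0) ^ 2 / (2 * (1 - 12 * |β'|))) + (1 + lam⁻¹) * 0 ^ 2)) :=
      (hcont.tendsto 0).mono_left nhdsWithin_le_nhds
    have hle := ge_of_tendsto htend (eventually_nhdsWithin_of_forall fun η hη => step lam hlam η hη)
    rw [add_zero, zero_pow two_ne_zero, mul_zero, add_zero] at hle
    exact hle
  have hcont2 : Continuous fun lam : ℝ => (1 + lam) * (σ ^ 2 / (2 * (1 - 12 * |β'|))) := (continuous_const.add continuous_id).mul continuous_const
  have htend2 : Tendsto (fun lam : ℝ => (1 + lam) * (σ ^ 2 / (2 * (1 - 12 * |β'|)))) (𝓝[>] 0) (𝓝 ((1 + 0) * (σ ^ 2 / (2 * (1 - 12 * |β'|))))) :=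
    (hcont2.tendsto 0).mono_left nhdsWithin_le_nhds
  have hle2 := ge_of_tendsto htend2 (eventually_nhdsWithin_of_forall fun lam hlam => step2 lam hlam)
  rw [add_zero, one_mul] at hle2
  exact hle2

end Summit.QuantumFields.YangMills.Theorems.ColdStartUniversality
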